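import Summits.CriticalPhenomena.PercolationContinuityZ3.Theorems.PercNearOneGluingNoHeavyLowerTailChampionStability
import Literature.Probability.LatticeModels.ProdBernoulliAtomExpansion
import HarnessLib

/-!
# `NoHeavyLowerTail` (stmt-CriticalPhenomena-4575) — two-port peeling: realisation invariance of glued relay laws

Route `PercNearOneGluingNoHeavy`, seat `prim-gen-swap` (gen 5); memo TWO-PORT-PEELING.md §5a ("realisation mismatch").  The MS-STAR₂₂ assembly
compares the SAME glued relay law realised by different sure pairs (e.g. "`a` glued to `b`" by the pair `s(a,b)`, or by `s(u,v)` when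
`u ≡ a` and `v ≡ b` almost surely).  This file proves that such realisations give the same probability to every statistic of a relay
count, and that an observer all of whose pairs have weight `0` is almost surely joined to no relay.
* `TwoPortPeeling.real_count_insert_eq_of_ae_reachable` — if `W s(x,y) = W s(x',y') = 0` and `x ↔ x'`, `y ↔ y'` almost surely under `W`, then
  `μ_{W[s(x,y)↦1]}(P(|π(z)|)) = μ_{W[s(x',y')↦1]}(P(|π(z)|))` for every vertex `z` and predicate `P`;
* `TwoPortPeeling.real_small_eq_zero_of_isolated` — if every pair at `u ∉ A` has weight `0`, `μ(1 ≤ |π(u)| ≤ j) = 0`.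
`μ_W = prodBernoulli W` on `Fin n`, relays `A`, `π(z) = {t ∈ A : z ↔ t}`.  No definitions, no named facts, no sorries.
-/

noncomputable section

namespace Summit.CriticalPhenomena.PercolationContinuityZ3.Theorems

open MeasureTheory Set Literature.Probability.LatticeModels Literature.Probability.Percolation
open scoped Classical BigOperators

variable {n : ℕ}

namespace TwoPortPeeling

open ChampionStability in
/-- Reachability after opening a pair whose endpoints are joined to `x', y'`: if `x ↔ x'` and `y ↔ y'` in `ω`, then for all `z, t`,
`z ↔ t` in `ω ∪ {s(x,y)}` iff `z ↔ t` in `ω ∪ {s(x',y')}`. [folklore] -/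
theorem reachable_insert_iff_of_linked (ω : BondConfig (Fin n)) {x y x' y' : Fin n} (hxy : x ≠ y) (hxy' : x' ≠ y')
    (hx : (openGraph ω).Reachable x x') (hy : (openGraph ω).Reachable y y') (z t : Fin n) :
    (openGraph (insert s(x, y) ω)).Reachable z t ↔ (openGraph (insert s(x', y') ω)).Reachable z t := by
  rw [reachable_insert_iff ω hxy z t, reachable_insert_iff ω hxy' z t]
  have hto : ∀ {p q p' q' : Fin n}, (openGraph ω).Reachable p p' → (openGraph ω).Reachable q q' →
      ((∃ s ∈ ({p, q} : Finset (Fin n)), (openGraph ω).Reachable z s) →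
        ∃ s ∈ ({p', q'} : Finset (Fin n)), (openGraph ω).Reachable z s) := by
    intro p q p' q' hp hq
    rintro ⟨s, hs, hzs⟩
    simp only [Finset.mem_insert, Finset.mem_singleton] at hs
    rcases hs with rfl | rfl
    · exact ⟨p', by simp, hzs.trans hp⟩
    · exact ⟨q', by simp, hzs.trans hq⟩
  have hfrom : ∀ {p q p' q' : Fin n}, (openGraph ω).Reachable p p' → (openGraph ω).Reachable q q' →
      ((∃ s ∈ ({p, q} : Finset (Fin n)), (openGraph ω).Reachable s t) →
        ∃ s ∈ ({p', q'} : Finset (Fin n)), (openGraph ω).Reachable s t) := by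
    intro p q p' q' hp hq
    rintro ⟨s, hs, hst⟩
    simp only [Finset.mem_insert, Finset.mem_singleton] at hs
    rcases hs with rfl | rfl
    · exact ⟨p', by simp, hp.symm.trans hst⟩
    · exact ⟨q', by simp, hq.symm.trans hst⟩
  constructor
  · rintro (h | ⟨h1, h2⟩)
    · exact Or.inl h
    · exact Or.inr ⟨hto hx hy h1, hfrom hx hy h2⟩
  · rintro (h | ⟨h1, h2⟩)
    · exact Or.inl h
    · exact Or.inr ⟨hto hx.symm hy.symm h1, hfrom hx.symm hy.symm h2⟩

open ChampionStability in
/-- **Realisation invariance.**  Let `W s(x,y) = W s(x',y') = 0` (`x ≠ y`, `x' ≠ y'`) and suppose `x ↔ x'` and `y ↔ y'` hold almost surely under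
`μ_W`.  Then raising `s(x,y)` or `s(x',y')` to `1` gives the same law to every statistic of every relay count:
`μ_{W[s(x,y)↦1]}(P(|π(z)|)) = μ_{W[s(x',y')↦1]}(P(|π(z)|))`. [folklore] -/
theorem real_count_insert_eq_of_ae_reachable (W : Sym2 (Fin n) → unitInterval) (A : Finset (Fin n)) {x y x' y' : Fin n}
    (z : Fin n) (P : ℕ → Prop) (hxy : x ≠ y) (hxy' : x' ≠ y') (hW : W s(x, y) = 0) (hW' : W s(x', y') = 0)
    (hnull : (prodBernoulli W).real {ω : BondConfig (Fin n) | ω ∉ openConn x x' ∨ ω ∉ openConn y y'} = 0) :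
    (prodBernoulli (Function.update W s(x, y) 1)).real
        {ω : BondConfig (Fin n) | P (A.filter fun t => ω ∈ openConn z t).card} =
      (prodBernoulli (Function.update W s(x', y') 1)).real
        {ω : BondConfig (Fin n) | P (A.filter fun t => ω ∈ openConn z t).card} := by
  rw [real_update_one_eq W hW, real_update_one_eq W hW']
  apply measureReal_congr
  set Z : Set (BondConfig (Fin n)) := {ω | ω ∉ openConn x x' ∨ ω ∉ openConn y y'} with hZ
  have hZ0 : prodBernoulli W Z = 0 := by
    have h := hnull
    rw [measureReal_def, ENNReal.toReal_eq_zero_iff] at h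
    exact h.resolve_right (measure_ne_top _ _)
  have hagree : ∀ ω, ω ∉ Z →
      (ω ∈ (fun ω : BondConfig (Fin n) => insert s(x, y) ω) ⁻¹'
          {ω : BondConfig (Fin n) | P (A.filter fun t => ω ∈ openConn z t).card} ↔
        ω ∈ (fun ω : BondConfig (Fin n) => insert s(x', y') ω) ⁻¹'
          {ω : BondConfig (Fin n) | P (A.filter fun t => ω ∈ openConn z t).card}) := by
    intro ω hω
    have hω' : (openGraph ω).Reachable x x' ∧ (openGraph ω).Reachable y y' := by
      simp only [hZ, mem_setOf_eq, not_or, not_not] at hω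
      exact ⟨hω.1, hω.2⟩
    simp only [mem_preimage, mem_setOf_eq]
    have hfilt : (A.filter fun t => insert s(x, y) ω ∈ openConn z t) = (A.filter fun t => insert s(x', y') ω ∈ openConn z t) :=
      Finset.filter_congr fun t _ => reachable_insert_iff_of_linked ω hxy hxy' hω'.1 hω'.2 z t
    rw [hfilt]
  refine ae_eq_set.2 ⟨measure_mono_null (fun ω hω => ?_) hZ0, measure_mono_null (fun ω hω => ?_) hZ0⟩
  · by_contra hZ'
    exact hω.2 ((hagree ω hZ').1 hω.1)
  · by_contra hZ'
    exact hω.2 ((hagree ω hZ').2 hω.1)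

/-- **An observer without pairs of positive weight is almost surely joined to no relay**: if `u ∉ A` and `w s(u,t) = 0` for all `t ≠ u`,
then `μ_w(1 ≤ |π(u)| ≤ j) = 0`. [folklore] -/
theorem real_small_eq_zero_of_isolated (w : Sym2 (Fin n) → unitInterval) (A : Finset (Fin n)) (u : Fin n) (j : ℕ)
    (hu : u ∉ A) (h0 : ∀ t : Fin n, t ≠ u → w s(u, t) = 0) :
    (prodBernoulli w).real {ω : BondConfig (Fin n) |
        1 ≤ (A.filter fun t => ω ∈ openConn u t).card ∧ (A.filter fun t => ω ∈ openConn u t).card ≤ j} = 0 := by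
  set F : Finset (Sym2 (Fin n)) := (Finset.univ.filter fun t : Fin n => t ≠ u).image (fun t => s(u, t)) with hF
  set Z : Set (BondConfig (Fin n)) := {ω | ∃ e ∈ F, e ∈ ω} with hZ
  have hF0 : ∀ e ∈ F, (w e : ℝ) = 0 := by
    intro e he
    obtain ⟨t, ht, rfl⟩ := Finset.mem_image.1 he
    have htu : t ≠ u := (Finset.mem_filter.1 ht).2
    simp [h0 t htu]
  have hZ0 : (prodBernoulli w).real Z = 0 := by
    rw [measureReal_def, prodBernoulli_setOf_exists_mem_eq_zero w F hF0, ENNReal.toReal_zero]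
  refine le_antisymm (le_trans (measureReal_mono fun ω hω => ?_) hZ0.le) measureReal_nonneg
  -- some relay is joined to `u`, so some pair at `u` is open
  obtain ⟨h1, -⟩ := hω
  obtain ⟨t, ht⟩ := Finset.card_pos.1 h1
  rw [Finset.mem_filter] at ht
  have htu : t ≠ u := fun h => hu (h ▸ ht.1)
  have hreach : (openGraph ω).Reachable u t := ht.2
  obtain ⟨p⟩ := hreach
  cases p with
  | nil => exact absurd rfl htu
  | cons hadj _ =>
    rw [openGraph_adj] at hadj
    exact ⟨s(u, _), Finset.mem_image.2 ⟨_, Finset.mem_filter.2 ⟨Finset.mem_univ _, fun h => hadj.2 h.symm⟩, rfl⟩, hadj.1⟩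

end TwoPortPeeling

end Summit.CriticalPhenomena.PercolationContinuityZ3.Theorems

end
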